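/-
Copyright (c) 2026. All rights reserved.
Released under Apache 2.0 license as described in the file LICENSE.
Authors: abc-iut cell, prover seat abc-iut-L4-d2 (gen 6).
-/
import Literature.AnabelianGeometry.AbsoluteAnabelian.GaloisTheatersNumberFieldShadowContext
import Literature.AnabelianGeometry.AbsoluteAnabelian.GaloisTheatersRmk511
import Literature.AnabelianGeometry.AbsoluteAnabelian.NumberFieldValuationProSetNonArchRigidityProofs
import Literature.AnabelianGeometry.AbsoluteAnabelian.NumberFieldValuationProSetArchTopologySeparationProofs
import HarnessLib

/-!
# [AbsTopIII] Rmk 5.1.1 and Cor 5.2 (i) PROVED at the number-field shadow context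

S. Mochizuki, *Topics in absolute anabelian geometry III* [MochizukiAbsTopIII2015], Rmk 5.1.1 p. 118 (uniqueness
of the reference isomorphism `ψ_V`; `φ_V` is determined by `φ_Π`) and Cor 5.2 (i) p. 119 (`An⊚[Th⊚] → Th⊚ → EA⊚` are
equivalences).  The cell types them as NAMED `Prop` FACTS over an interface context `R : GlobalAnabelianContext`
(`GaloisTheaters.lean`: `ReferenceIsoUnique` F-0109, `TheaterHomDeterminedByGroupHom` F-0110,
`TheaterIsoCanonical` F-0111, `EAHomExtendsToTheaters`) — ASSUMPTIONS on `R` whose universal closures are false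
(`GaloisTheatersRmk511Schema.lean`, `GaloisTheatersCor52iSchema.lean`) and which abc-iut-f-098 discharged
CONDITIONALLY along print's argument (`GaloisTheatersRmk511.lean`: `referenceIsoUnique_of_separated`,
`theaterHomDeterminedByGroupHom_of_separated`, `theaterIsoCanonical_of_mapKNF_id`).

THIS PROOF-ONLY FILE proves all four AT `R := NumberFieldShadow.context F` — the `GlobalAnabelianContext` TERM of the
number-field arithmetic shadow (`GaloisTheatersNumberFieldShadowContext.lean`, abc-iut-L4-d2 g6: `V⊚ := V⊚(ℚ̄/ℚ)`
through `ℚ`-charts, `mapProVal`/`mapKNF` := conjugators):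

* `context_hnon` / `context_hnon_open` — (non): on an ADMISSIBLE `Π_E`, a nonarchimedean element of `V⊚(Π_E)` is
  determined by (the trace on any open subgroup of `Π_E` of) its decomposition group — abc-iut-w6-d038's
  `eq_of_mem_non_of_isOpen_inf_decomp_le` ([NSW] Cor. 12.1.3 at `V⊚(ℚ̄/ℚ)`) pushed through the chart (the image
  of an open subgroup under a virtual chart is open, `VirtualChart.isOpen_image_of_le`);
* `context_harc` — (arc): archimedean elements are separated by the `κ_{ell,v}`-induced topologies on `k_NF = ℚ̄`
  (abc-iut-w6-d038's `infinitePlace_eq_of_induced_embedding_eq`);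
* `conjugator_id`, `context_mapKNF_id` — the conjugator of `𝟙_Π` is `1` (slimness of `G_ℚ`), so `k_NF(𝟙_Π) = id`;
* **`referenceIsoUnique_context`** (F-0109), **`theaterHomDeterminedByGroupHom_context`** (F-0110),
  **`theaterIsoCanonical_context`** (F-0111), **`eaHomExtendsToTheaters_context`** (Cor 5.2 (i), full
  faithfulness: every morphism of `EA⊚` between admissible objects extends to a morphism of the canonical theaters,
  `φ_V := V⊚(f)` = translation by the conjugator, `φ_v` on `A = ℂ` the identity or complex conjugation).

HONEST LABEL: «instance PROVED at the number-field SHADOW context» (`Δ = 1`, stub archimedean geometry) — NOT at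
print's `EA⊚` of hyperbolic orbicurves (no étale `π₁` in the tree; E-L4-13); the rows stay assumptions at the
intended model.  Classical; nothing here bears on [IUTchIII] Cor. 3.12 or takes a side; typed ≠ proved elsewhere.
-/

noncomputable section

open scoped Pointwise Topology
open CategoryTheory NumberField Field TopologicalSpace

namespace Literature.AnabelianGeometry.AbsoluteAnabelian

namespace NumberFieldShadow

variable (F : Type) [Field F] [NumberField F]

/-! ### The conjugator of the identity; `k_NF(𝟙) = id` -/

/-- The conjugator of `𝟙_Π` is trivial (on a charted `Π` it centralises the open subgroup `ratChart(W)` of `G_ℚ`,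
hence is `1` by slimness; on the chartless component it is `1` by definition).
[cite: MochizukiAbsAnab2004, Thm 1.1.1 (ii) p.6] -/
theorem conjugator_id (E : FundamentalExtension.{0}) : conjugator (𝟙 E) (isEAHom_id E) = 1 := by
  by_cases h : HasRatChart E
  · obtain ⟨W, _, hinj, hop⟩ := ratChart_spec h
    have key := ratChart_comp_eq_conj (𝟙 E) (isEAHom_id E)
    refine VirtualChart.rat_hslim (W.map (ratChart E).toMonoidHom) (by rw [Subgroup.coe_map]; exact hop) _ ?_
    rintro _ ⟨g, _, rfl⟩
    exact (key g).symm
  · rw [conjugator, dif_neg h]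

/-- **`k_NF(𝟙_Π) = id`** at the shadow context (functoriality of `k_NF(−)` at identities, observation I-L4-t3-1).
[cite: MochizukiAbsTopIII2015, Def 5.1 (ii) p.114] -/
theorem context_mapKNF_id (E : FundamentalExtension.{0}) (x : (context F).kNF E) :
    (context F).mapKNF (𝟙 E) (isEAHom_id E) x = x := by
  change absoluteGaloisGroup.toAlgEquiv ℚ (conjugator (𝟙 E) (isEAHom_id E)) x = x
  rw [conjugator_id, map_one]
  rfl

/-- `V⊚(𝟙_Π) = id` at the shadow context. [cite: MochizukiAbsTopIII2015, Def 5.1 (iii) p.115] -/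
theorem context_mapProVal_id (E : FundamentalExtension.{0}) (v : ((context F).proVal E).carrier) :
    (context F).mapProVal (𝟙 E) (isEAHom_id E) v = v := by
  letI := (NumberField.valuationProSet ℚ).action
  change conjugator (𝟙 E) (isEAHom_id E) • (show (NumberField.valuationProSet ℚ).carrier from v) = _
  rw [conjugator_id, one_smul]

/-! ### (non) and (arc) separation at the shadow context -/

/-- **(non), open-subgroup form, at the shadow context**: for an admissible `Π_E`, nonarchimedean `v, w ∈ V⊚(Π_E)` and
an open subgroup `U ⊆ Π_E` with `U ∩ Π_v ⊆ Π_w`, `v = w` ([NSW] Cor. 12.1.3 at `V⊚(ℚ̄/ℚ)` through the chart).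
[cite: NeukirchSchmidtWingberg2008, Cor. 12.1.3] -/
theorem context_hnon_open : ∀ E, (context F).IsAdmissible E →
    ∀ v w : ((context F).proVal E).carrier, v ∈ ((context F).proVal E).non → w ∈ ((context F).proVal E).non →
    ∀ U : Subgroup E.arith, IsOpen (U : Set E.arith) →
    U ⊓ ((context F).proVal E).decomp v ≤ ((context F).proVal E).decomp w → v = w := by
  intro E hE v w hv hw U hU h
  obtain ⟨W, hW, hinj, hop⟩ := ratChart_spec (hasRatChart_of_isAdmissible F hE)
  have hU' : IsOpen (((U ⊓ W).map (ratChart E).toMonoidHom : Subgroup (absoluteGaloisGroup ℚ)) :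
      Set (absoluteGaloisGroup ℚ)) := by
    rw [Subgroup.coe_map]
    exact VirtualChart.isOpen_image_of_le (ratChart E) hW hinj hop (hU.inter hW) inf_le_right
  refine NumberFieldValuationProSet.eq_of_mem_non_of_isOpen_inf_decomp_le ℚ hv hw _ hU' ?_
  rintro _ ⟨⟨g, ⟨hgU, -⟩, rfl⟩, hgv⟩
  have hg : g ∈ U ⊓ ((context F).proVal E).decomp v := by
    refine ⟨hgU, ?_⟩
    change g ∈ ((NumberField.valuationProSet ℚ).comap (ratChart E)).decomp v
    rw [GaloisProSet.decomp_comap]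
    exact hgv
  have hgw := h hg
  change g ∈ ((NumberField.valuationProSet ℚ).comap (ratChart E)).decomp w at hgw
  rw [GaloisProSet.decomp_comap] at hgw
  exact hgw

/-- **(non) at the shadow context**: decomposition groups separate the nonarchimedean elements of `V⊚(Π_E)`,
`Π_E` admissible. [cite: NeukirchSchmidtWingberg2008, Cor. 12.1.3] -/
theorem context_hnon : ∀ E, (context F).IsAdmissible E →
    ∀ v w : ((context F).proVal E).carrier, v ∈ ((context F).proVal E).non → w ∈ ((context F).proVal E).non →
    ((context F).proVal E).decomp v = ((context F).proVal E).decomp w → v = w :=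
  fun E hE v w hv hw h => context_hnon_open F E hE v w hv hw ⊤ isOpen_univ (by rw [h]; exact inf_le_right)

/-- **(arc) at the shadow context**: the topologies induced on `k_NF = ℚ̄` by `κ_{ell,v} : ℚ̄ ↪ A = ℂ` separate the
archimedean elements. [cite: MochizukiAbsTopIII2015, Rmk 5.1.1 p.118] -/
theorem context_harc : ∀ E, (context F).IsAdmissible E → ∀ v w : ((context F).proVal E).arc,
    induced ((context F).κell E v) ((context F).archSpace E v).topA =
      induced ((context F).κell E w) ((context F).archSpace E w).topA → v = w := by
  intro E _ v w h
  have h' : induced (contextArcPlace E v).embedding (inferInstance : TopologicalSpace ℂ) =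
      induced (contextArcPlace E w).embedding (inferInstance : TopologicalSpace ℂ) := h
  have e : contextArcPlace E v = contextArcPlace E w := infinitePlace_eq_of_induced_embedding_eq h'
  apply Subtype.ext
  rw [← inr_inr_contextArcPlace E v, ← inr_inr_contextArcPlace E w, e]

/-! ### Rmk 5.1.1 and Cor 5.2 (i) (essential surjectivity) at the shadow context -/

/-- **Rmk 5.1.1 (F-0109) PROVED at the number-field shadow context**: the reference isomorphism of every global
Galois-theater over `NumberFieldShadow.context F` is unique. [cite: MochizukiAbsTopIII2015, Rmk 5.1.1 p.118] -/
theorem referenceIsoUnique_context : ReferenceIsoUnique (context F) :=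
  referenceIsoUnique_of_separated (context F) (context_hnon F) (context_harc F)

/-- **Rmk 5.1.1, last sentence (F-0110) PROVED at the number-field shadow context**: in a morphism of global
Galois-theaters over `NumberFieldShadow.context F`, `φ_V` is determined by `φ_Π`.
[cite: MochizukiAbsTopIII2015, Rmk 5.1.1 p.118] -/
theorem theaterHomDeterminedByGroupHom_context : TheaterHomDeterminedByGroupHom (context F) :=
  theaterHomDeterminedByGroupHom_of_separated (context F) (context_hnon_open F) (context_harc F)

/-- **Cor 5.2 (i), essential surjectivity (F-0111) PROVED at the number-field shadow context**: every global
Galois-theater over `NumberFieldShadow.context F` is isomorphic over `𝟙_Π` to the canonical theater `V⊚(Π)`.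
[cite: MochizukiAbsTopIII2015, Cor 5.2 (i) p.119] -/
theorem theaterIsoCanonical_context : TheaterIsoCanonical (context F) :=
  theaterIsoCanonical_of_mapKNF_id (context F) (context_mapKNF_id F)

/-! ### Cor 5.2 (i) (full faithfulness) at the shadow context -/

/-- Translation by `τ ∈ Π` maps the nonarchimedean elements of a Galois pro-set ONTO themselves.
[cite: MochizukiAbsTopIII2015, Def 5.1 (i) p.113] -/
theorem image_smul_non {P : Type} [Group P] [TopologicalSpace P] (V : GaloisProSet P) (τ : P) :
    (fun v : V.carrier => τ • v) '' V.non = V.non := by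
  ext v
  constructor
  · rintro ⟨w, hw, rfl⟩
    exact V.smul_mem_non τ hw
  · intro hv
    exact ⟨τ⁻¹ • v, V.smul_mem_non τ⁻¹ hv, smul_inv_smul τ v⟩

/-- Translation by `τ ∈ Π` maps the archimedean elements of a Galois pro-set ONTO themselves.
[cite: MochizukiAbsTopIII2015, Def 5.1 (i) p.113] -/
theorem image_smul_arc {P : Type} [Group P] [TopologicalSpace P] (V : GaloisProSet P) (τ : P) :
    (fun v : V.carrier => τ • v) '' V.arc = V.arc := by
  ext v
  constructor
  · rintro ⟨w, hw, rfl⟩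
    exact V.smul_mem_arc τ hw
  · intro hv
    exact ⟨τ⁻¹ • v, V.smul_mem_arc τ⁻¹ hv, smul_inv_smul τ v⟩

/-- The infinite place under the translate `τ • v` of an archimedean element is the translate of the place under
`v`. [cite: MochizukiAbsTopIII2015, Def 5.1 (i) p.113] -/
theorem contextArcPlace_smul {E₁ E₂ : FundamentalExtension.{0}} (τ : absoluteGaloisGroup ℚ)
    (v : (contextProVal E₁).arc) (hv : (letI := (NumberField.valuationProSet ℚ).action;
      τ • (show (NumberField.valuationProSet ℚ).carrier from v.1)) ∈ (contextProVal E₂).arc) :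
    contextArcPlace E₂ ⟨_, hv⟩ = (letI := NumberFieldValuationProSet.archAction ℚ; τ • contextArcPlace E₁ v) := by
  letI := NumberFieldValuationProSet.archAction ℚ
  letI := (NumberField.valuationProSet ℚ).action
  have h1 := inr_inr_contextArcPlace E₂ ⟨_, hv⟩
  have h2 : (Sum.inr (Sum.inr (τ • contextArcPlace E₁ v)) : NumberFieldValuationProSet.Carrier ℚ) =
      τ • (show (NumberField.valuationProSet ℚ).carrier from v.1) := by
    rw [← inr_inr_contextArcPlace E₁ v]
    rfl
  have h := h1.trans h2.symm
  simpa using h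

/-- **Cor 5.2 (i), full faithfulness, PROVED at the number-field shadow context**: every morphism `f` of `EA⊚`
between admissible objects extends to a morphism `V⊚(Π₁) → V⊚(Π₂)` of the canonical theaters over `f` —
`φ_V := V⊚(f)` (translation by the conjugator `τ_f`), and at an archimedean `v ↦ τ_f • v` the isomorphism of (stub)
Aut-holomorphic orbispaces acts on `A = ℂ` by the identity or by complex conjugation, according as the chosen
embeddings of the two places correspond under `τ_f` or up to conjugation. [cite: MochizukiAbsTopIII2015, Cor 5.2 (i) p.119] -/
theorem eaHomExtendsToTheaters_context : EAHomExtendsToTheaters (context F) := by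
  intro E₁ E₂ h₁ h₂ f hf
  letI := (NumberField.valuationProSet ℚ).action
  letI := NumberFieldValuationProSet.archAction ℚ
  -- the geometric parts: `f` restricts to a topological isomorphism `Δ₁ ≅ Δ₂`
  have hbij := hf.bijOn_geom
  let r : E₁.geom →* E₂.geom :=
    (f.arith.toMonoidHom.restrict E₁.geom).codRestrict E₂.geom fun a => hbij.mapsTo a.2
  have hrbij : Function.Bijective r := by
    refine ⟨fun a b h => Subtype.ext (hbij.injOn a.2 b.2 (congrArg Subtype.val h)), fun b => ?_⟩
    obtain ⟨a, ha, hab⟩ := hbij.surjOn b.2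
    exact ⟨⟨a, ha⟩, Subtype.ext hab⟩
  haveI : CompactSpace E₁.geom := isCompact_iff_compactSpace.mp E₁.isClosed_geom.isCompact
  let e₀ : E₁.geom ≃* E₂.geom := MulEquiv.ofBijective r hrbij
  have hc : Continuous e₀ := (f.arith.continuous.comp continuous_subtype_val).subtype_mk _
  let eΔ : E₁.geom ≃ₜ* E₂.geom :=
    { e₀ with
      continuous_toFun := hc
      continuous_invFun := Continuous.continuous_symm_of_equiv_compact_to_t2 (f := e₀.toEquiv) hc }
  have heΔ : ∀ a : E₁.geom, ((eΔ a : E₂.geom) : E₂.arith) = f.arith a := fun _ => rfl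
  -- complex conjugation as a bicontinuous field automorphism of `ℂ`
  have hconj : IsHomeomorph (fun z : ℂ => Complex.conjAe.toRingEquiv z) :=
    (Homeomorph.mk ⟨fun z : ℂ => Complex.conjAe.toRingEquiv z, fun z => Complex.conjAe.toRingEquiv z,
      fun z => by simp [Complex.conjAe_coe], fun z => by simp [Complex.conjAe_coe]⟩
      (by simpa [Complex.conjAe_coe] using Complex.continuous_conj)
      (by simpa [Complex.conjAe_coe] using Complex.continuous_conj)).isHomeomorph
  let τ := conjugator f hf
  refine ⟨{ φgrp := f
            isEAHom := hf
            φV := (context F).mapProVal f hf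
            φV_smul := (context F).mapProVal_smul f hf
            φV_generic := contextMapProVal_generic f hf
            image_non := image_smul_non (NumberField.valuationProSet ℚ) τ
            image_arc := image_smul_arc (NumberField.valuationProSet ℚ) τ
            arch_compat := fun v hv => ?_ }, rfl⟩
  -- the archimedean compatibility at `v ↦ τ • v`
  let w : InfinitePlace (AlgebraicClosure ℚ) := contextArcPlace E₁ v
  have hw₂ : contextArcPlace E₂ ⟨_, hv⟩ = τ • w := contextArcPlace_smul τ v hv
  let τA : AlgebraicClosure ℚ ≃ₐ[ℚ] AlgebraicClosure ℚ := absoluteGaloisGroup.toAlgEquiv ℚ τ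
  have hmk : InfinitePlace.mk (τ • w).embedding =
      InfinitePlace.mk (w.embedding.comp (τA.symm : AlgebraicClosure ℚ →+* AlgebraicClosure ℚ)) := by
    rw [InfinitePlace.mk_embedding, ← InfinitePlace.smul_mk, InfinitePlace.mk_embedding]
    rfl
  -- the `κ`-clause, in the two cases of `mk_eq_iff`
  have hκ₂ : ∀ x : AlgebraicClosure ℚ,
      (context F).κell E₂ ⟨_, hv⟩ ((context F).mapKNF f hf x) = (τ • w).embedding (τA x) := by
    intro x
    change (contextArcPlace E₂ ⟨_, hv⟩).embedding (τA x) = _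
    rw [hw₂]
  rcases InfinitePlace.mk_eq_iff.mp hmk with hφ | hφ
  · -- the chosen embeddings correspond under `τ`: `φ_v` acts on `A = ℂ` by the identity
    refine ⟨⟨Homeomorph.refl _, RingEquiv.refl _, eΔ⟩, (Homeomorph.refl ℂ).isHomeomorph,
      ⟨1, fun a => ?_⟩, fun x => ?_⟩
    · simp only [one_mul, inv_one, mul_one]
      rfl
    · rw [hκ₂]
      change (τ • w).embedding (τA x) = w.embedding x
      have hx := congrArg (fun φ : AlgebraicClosure ℚ →+* ℂ => φ (τA x)) hφ
      simp only [RingHom.coe_comp, Function.comp_apply] at hx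
      rw [show ((τA.symm : AlgebraicClosure ℚ →+* AlgebraicClosure ℚ) (τA x)) = x from τA.symm_apply_apply x]
        at hx
      exact hx
  · -- they correspond up to conjugation: `φ_v` acts on `A = ℂ` by complex conjugation
    refine ⟨⟨Homeomorph.refl _, Complex.conjAe.toRingEquiv, eΔ⟩, hconj, ⟨1, fun a => ?_⟩, fun x => ?_⟩
    · simp only [one_mul, inv_one, mul_one]
      rfl
    · rw [hκ₂]
      change (τ • w).embedding (τA x) = Complex.conjAe.toRingEquiv (w.embedding x)
      have hx := congrArg (fun φ : AlgebraicClosure ℚ →+* ℂ => φ (τA x)) hφ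
      simp only [RingHom.coe_comp, Function.comp_apply] at hx
      rw [show ((τA.symm : AlgebraicClosure ℚ →+* AlgebraicClosure ℚ) (τA x)) = x from τA.symm_apply_apply x]
        at hx
      -- `hx : conjugate ((τ • w).embedding) (τA x) = w.embedding x`
      rw [← hx, ComplexEmbedding.conjugate_coe_eq]
      simp [Complex.conjAe_coe]

end NumberFieldShadow

end Literature.AnabelianGeometry.AbsoluteAnabelian

end
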